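import Mathlib.Dynamics.Ergodic.MeasurePreserving
import Literature.Analysis.FluidPDE.HardSpherePhaseSpace
import HarnessLib

/-!
# The square-shoulder (penetrable-sphere) flow

Event-driven dynamics of `N` unit-mass particles on a position space with a `Geometry`
(`Literature.Analysis.FluidPDE.HardSpherePhaseSpace`) interacting through the STEP pair potential
`V₀ · 1(r < ε)` — the *penetrable-sphere* / *square-shoulder* model (Santos 2005 §2, eq. (1):
`φ(r) = ε > 0` for `r < σ`, `0` for `r > σ`; square-well / step-potential molecular dynamics goes
back to Alder–Wainwright 1959). Particles move by free flight; when a pair `{i, j}` reaches the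
range, `‖x_i - x_j‖ = ε`, with signed normal relative speed `g_n = ⟪v_i - v_j, n⟫/‖n‖`
(`n = x_i - x_j`), the velocities of the pair jump (Santos 2005 §2: reduced mass `1/2`, the pair
penetrates iff the normal relative kinetic energy `g_n²/4` exceeds the step, "double refraction",
otherwise it is deflected as by a hard sphere, "total reflection"):

* ENTERING (`g_n < 0`) with `g_n²/4 > V₀`: transmission (refraction in), the normal relative speed
  becomes `-(g_n² - 4V₀)^{1/2}`, tangential relative velocity and pair momentum unchanged;
* ENTERING with `g_n²/4 ≤ V₀`: specular reflection `reflectVel` (the hard-sphere law);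
* LEAVING (`0 < g_n`, the pair was overlapping) with `g_n² + 4V₀ > 0`: transmission (refraction
  out), normal relative speed `(g_n² + 4V₀)^{1/2}`; otherwise (only possible for a well, `V₀ < 0`)
  specular reflection back into the core;
* grazing (`g_n = 0`): nothing happens.

At every event the pair momentum is conserved and the kinetic energy pays exactly the jump it
crosses (`shoulderVel_fst_add_snd`, `kinetic_shoulderVel_add_shoulderJump`,
`configEnergy_shoulderCollidePair_add_shoulderJump`) — the event-level content of the conservation
of `H = ½ ∑ ‖v_i‖² + V₀ · #{overlapping pairs}` (`shoulderEnergy`; the along-trajectory statement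
needs continuity of the pair distances of the geometry and is not proved here). For `V₀ = +∞` (no
transmission) this is the hard-sphere dynamics; quantitatively, a non-receding pair of a
configuration whose kinetic energy is at most `V₀` is reflected exactly as by `collidePair`
(`shoulderCollidePair_eq_collidePair_of_configEnergy_le`).

* `shoulderVel V₀ n p`, `shoulderCollidePair G V₀ i j z`: the pair rule and the event map;
* `overlapPairs`, `shoulderEnergy`: overlapping pairs and the conserved energy;
* `crossingTimes`, `IsShoulderCritical`, `IsSquareShoulderTrajectory G V₀ ε N γ`: event times,
  critical (threshold) events, and the trajectory predicate — the analogue of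
  `IsHardSphereTrajectory` (right-continuous at events, free flight between, binary non-grazing
  non-critical events resolved by `shoulderCollidePair` from the left limit);
* `SquareShoulderFlow G V₀ ε N`: HYPOTHESIS STRUCTURE copying `HardSphereFlow`
  (`HardSphereDynamics`) field for field (Lebesgue-conull measurable invariant good set, group law,
  measurability, preservation of the Liouville = Lebesgue measure `volume` on the whole phase
  space, orbits are trajectories).

## Mathlib / Literature reuse

Everything static is from `HardSpherePhaseSpace` (`Geometry`, `Config`, `reflectVel`,
`collidePair`, `freeFlight`, `configEnergy`, `configMomentum`, `IsGrazing`, `IsOutgoing`,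
`hardSphereDomain`, `Torus.geometry`), the only Literature import; `HardSphereDynamics` gives the
pattern (`IsHardSphereTrajectory`, `HardSphereFlow`) and is deliberately not imported (nothing of
it is used). Mathlib has no billiard / step-potential dynamics
(`lean search 'refract|square.?well|penetrable'`: nothing relevant).

## Design choices

* Entering / leaving is read off the SIGN of `g_n` in the left limit: positions are continuous and
  free flight is affine, so a pair reaching `‖x_i - x_j‖ = ε` from outside has `g_n ≤ 0` and from
  inside `g_n ≥ 0`; the grazing case `g_n = 0` is excluded on trajectories (as for hard spheres).
* The rule is stated for every real `V₀` (shoulder `V₀ > 0`, well `V₀ < 0`, `V₀ = 0` = free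
  flight).
* Threshold ("critical") events `g_n² = 4 V₀` entering (resp. `g_n² = -4V₀` leaving a well) are
  resolved as reflections by `shoulderVel` but EXCLUDED on trajectories (`IsShoulderCritical`), like
  grazing and multiple events: the good set of a flow avoids them.
* Phase space is all of `Config N d X` (cores are penetrable), so the invariant measure is `volume`
  itself and there is no `good_subset` field.
* EXISTENCE IS NOT VENDORED. The Alexander-type theorem "for `0 < V₀`, `0 < ε < 1/2` and every `N`,
  `Nonempty (SquareShoulderFlow (Torus.geometry d) V₀ ε N)`" (outside a Lebesgue-null set of data
  leading to grazing, critical, multiple or non-locally-finite events the event-driven dynamics is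
  globally defined, measurable and volume preserving) is taken for granted in the
  molecular-dynamics / kinetic literature since Alder–Wainwright 1959, but a printed
  measure-theoretic proof is known to us only for hard spheres (`V₀ = +∞`: Alexander 1975, in tree
  `HardSphereFlow.nonempty_torus_holds` via `HardSphereFlowConstruction` … `HardSphereAlexander`,
  whose scheme — countably many smooth volume-preserving event maps, singular data of positive
  codimension — is expected to carry over). It is therefore neither a citable fact nor stated here
  as an undischarged `Prop` (which would put debt into the import cone of every route using this
  file): a route that needs it states `Nonempty (SquareShoulderFlow (Torus.geometry (Fin 3)) V₀ ε N)`
  as its own item, or quantifies over `Φ : SquareShoulderFlow …` as the typed rungs already do for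
  Newtonian flows.
* Also NOT here: time reversal, BBGKY, the along-trajectory conservation laws.

## References

* A. Santos, *Kinetic Theory of Soft Matter: The Penetrable-Sphere Model*, in: Rarefied Gas
  Dynamics 24, AIP Conf. Proc. 762 (2005) 276–281, doi:10.1063/1.1941550, arXiv:cond-mat/0501068,
  §2 (collision process, eq. (1)).
* B. J. Alder, T. E. Wainwright, *Studies in Molecular Dynamics. I. General Method*, J. Chem.
  Phys. 31 (1959) 459–466 (event-driven dynamics for square-well potentials).
* P. Borgelt, C. Hoheisel, *Convergence of the hard soft sphere potential to the hard sphere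
  potential. A molecular dynamics study of transport coefficients*, J. Chem. Phys. 91 (1989)
  7872–7876, doi:10.1063/1.457254 (the `V₀ → ∞` limit, numerically).
* J. L. Sánchez-Tena, A. Santos, P. Pajuelo, *Kinetic theory of soft matter. The penetrable
  square-well model*, RGD31, AIP Conf. Proc. 2132 (2019) 190001, doi:10.1063/1.5119673 (the well,
  `V₀ < 0`).
* R. K. Alexander, *The infinite hard sphere system*, PhD thesis, Berkeley (1975) (the `V₀ = ∞`
  existence theorem; in tree `HardSphereFlow.nonempty_torus_holds`).
-/

open MeasureTheory Set Filter Topology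
open scoped InnerProductSpace

namespace Literature.Analysis.FluidPDE

noncomputable section

/-! ## The pair rule for a potential step -/

section PairRule

variable {E : Type*} [NormedAddCommGroup E] [InnerProductSpace ℝ E]

/-- The signed normal relative speed `g_n = ⟪v - w, n⟫ / ‖n‖` of a pair of velocities
`p = (v, w)` along the (unnormalised) direction `n`; for `n = x_i - x_j` it is negative when the
two particles approach and positive when they recede (Santos 2005 §2: `g cos α`, `α` the incidence
angle). Junk value `0` at `n = 0`. [folklore] -/
def normalRelSpeed (n : E) (p : E × E) : ℝ := ⟪p.1 - p.2, n⟫_ℝ / ‖n‖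

/-- Unfolding lemma for `normalRelSpeed`. [folklore] -/
theorem normalRelSpeed_eq (n : E) (p : E × E) : normalRelSpeed n p = ⟪p.1 - p.2, n⟫_ℝ / ‖n‖ := rfl

/-- Replace the normal relative speed of the pair `p = (v, w)` along `n` by `g'`, keeping the
tangential relative velocity and the total momentum (unit masses):
`v' = v + a n/‖n‖`, `w' = w - a n/‖n‖` with `a = (g' - g_n)/2`. [folklore] -/
def setNormalRelSpeed (n : E) (p : E × E) (g' : ℝ) : E × E :=
  (p.1 + ((g' - normalRelSpeed n p) / 2 * ‖n‖⁻¹) • n,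
    p.2 - ((g' - normalRelSpeed n p) / 2 * ‖n‖⁻¹) • n)

/-- The potential jump met by a pair that reaches the range of the step potential `V₀ · 1(r < ε)`
with normal relative speed `g`: `+V₀` when approaching (`g < 0`, entering the core), `-V₀` when
receding (`0 < g`, leaving the core), `0` when grazing (Santos 2005 §2). [cite: Santos2005, §2] -/
def shoulderJump (V₀ g : ℝ) : ℝ := if g < 0 then V₀ else if 0 < g then -V₀ else 0

/-- The normal relative speed after TRANSMISSION through the step, from the energy balance of the
relative motion with reduced mass `1/2`, `g'²/4 + ΔV = g²/4`, with the sign of `g`: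
`-(g² - 4V₀)^{1/2}` entering, `(g² + 4V₀)^{1/2}` leaving (Santos 2005 §2: inside the core the pair
moves with reduced kinetic energy `g*² - 1`, `g* = g/(2√V₀)` for unit masses). [cite: Santos2005, §2] -/
def transmittedNormalSpeed (V₀ g : ℝ) : ℝ :=
  if g < 0 then -Real.sqrt (g ^ 2 - 4 * V₀) else Real.sqrt (g ^ 2 + 4 * V₀)

/-- **The square-shoulder pair rule** for velocities `p = (v, w)` and impact direction `n`
(`= x_i - x_j`, of norm `ε` at an event) of the step potential of height `V₀` (Santos 2005 §2):
if the normal relative kinetic energy exceeds the jump, `g_n²/4 > ΔV` (`ΔV = shoulderJump V₀ g_n`),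
the pair is transmitted (refracted: normal relative speed `transmittedNormalSpeed V₀ g_n`, tangential
part and momentum unchanged), otherwise it is specularly reflected (`reflectVel`, the hard-sphere
law — "total reflection"). Grazing pairs (`g_n = 0`) and `n = 0` are left unchanged. [cite: Santos2005, §2] -/
def shoulderVel (V₀ : ℝ) (n : E) (p : E × E) : E × E :=
  if 4 * shoulderJump V₀ (normalRelSpeed n p) < normalRelSpeed n p ^ 2 then
    setNormalRelSpeed n p (transmittedNormalSpeed V₀ (normalRelSpeed n p))
  else reflectVel n p

/-- `setNormalRelSpeed` conserves the momentum of the pair. [folklore] -/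
@[simp]
theorem setNormalRelSpeed_fst_add_snd (n : E) (p : E × E) (g' : ℝ) :
    (setNormalRelSpeed n p g').1 + (setNormalRelSpeed n p g').2 = p.1 + p.2 := by
  simp only [setNormalRelSpeed]
  abel

/-- `setNormalRelSpeed n p g'` has normal relative speed `g'` (for `n ≠ 0`). [folklore] -/
@[simp]
theorem normalRelSpeed_setNormalRelSpeed {n : E} (hn : n ≠ 0) (p : E × E) (g' : ℝ) :
    normalRelSpeed n (setNormalRelSpeed n p g') = g' := by
  have hn' : ‖n‖ ≠ 0 := norm_ne_zero_iff.2 hn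
  have key : ∀ c : ℝ, normalRelSpeed n (p.1 + c • n, p.2 - c • n) =
      normalRelSpeed n p + 2 * c * ‖n‖ := by
    intro c
    simp only [normalRelSpeed]
    have hsub : p.1 + c • n - (p.2 - c • n) = (p.1 - p.2) + (2 * c) • n := by
      rw [mul_smul, two_smul]
      abel
    rw [hsub, inner_add_left, real_inner_smul_left, real_inner_self_eq_norm_sq]
    field_simp
  rw [setNormalRelSpeed, key]
  field_simp
  ring

/-- Kinetic energy after `setNormalRelSpeed`: only the normal relative part changes,
`‖v'‖² + ‖w'‖² = ‖v‖² + ‖w‖² + (g'² - g_n²)/2` (for `n ≠ 0`). [folklore] -/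
theorem norm_sq_setNormalRelSpeed {n : E} (hn : n ≠ 0) (p : E × E) (g' : ℝ) :
    ‖(setNormalRelSpeed n p g').1‖ ^ 2 + ‖(setNormalRelSpeed n p g').2‖ ^ 2 =
      ‖p.1‖ ^ 2 + ‖p.2‖ ^ 2 + (g' ^ 2 - normalRelSpeed n p ^ 2) / 2 := by
  have hn' : ‖n‖ ≠ 0 := norm_ne_zero_iff.2 hn
  have key : ∀ c : ℝ, ‖p.1 + c • n‖ ^ 2 + ‖p.2 - c • n‖ ^ 2 =
      ‖p.1‖ ^ 2 + ‖p.2‖ ^ 2 + 2 * c * (normalRelSpeed n p * ‖n‖) + 2 * c ^ 2 * ‖n‖ ^ 2 := by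
    intro c
    have h1 : normalRelSpeed n p * ‖n‖ = ⟪p.1, n⟫_ℝ - ⟪p.2, n⟫_ℝ := by
      rw [normalRelSpeed, inner_sub_left]
      field_simp
    rw [h1, norm_add_sq_real, norm_sub_sq_real]
    simp only [real_inner_smul_right, norm_smul, Real.norm_eq_abs, mul_pow, sq_abs]
    ring
  simp only [setNormalRelSpeed]
  rw [key]
  field_simp
  ring

/-- The specular reflection is `setNormalRelSpeed` with reversed normal speed `-g_n`. [folklore] -/
theorem setNormalRelSpeed_neg_normalRelSpeed (n : E) (p : E × E) :
    setNormalRelSpeed n p (-normalRelSpeed n p) = reflectVel n p := by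
  simp only [setNormalRelSpeed, reflectVel, normalRelSpeed]
  have h : (-(⟪p.1 - p.2, n⟫_ℝ / ‖n‖) - ⟪p.1 - p.2, n⟫_ℝ / ‖n‖) / 2 * ‖n‖⁻¹ =
      -(⟪p.1 - p.2, n⟫_ℝ / ‖n‖ ^ 2) := by
    ring
  rw [h, neg_smul, ← sub_eq_add_neg, sub_neg_eq_add]

/-- The square of the normal relative speed is at most `‖v - w‖² ≤ 2 (‖v‖² + ‖w‖²)` (Cauchy–Schwarz
and the parallelogram law). [folklore] -/
theorem normalRelSpeed_sq_le (n : E) (p : E × E) :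
    normalRelSpeed n p ^ 2 ≤ 2 * (‖p.1‖ ^ 2 + ‖p.2‖ ^ 2) := by
  have h1 : |normalRelSpeed n p| ≤ ‖p.1 - p.2‖ := by
    unfold normalRelSpeed
    by_cases hn : ‖n‖ = 0
    · simp [hn]
    · rw [abs_div, abs_norm, div_le_iff₀ (lt_of_le_of_ne (norm_nonneg n) (Ne.symm hn))]
      exact abs_real_inner_le_norm _ _
  have h2 : ‖p.1 - p.2‖ ^ 2 ≤ 2 * (‖p.1‖ ^ 2 + ‖p.2‖ ^ 2) := by
    linarith [norm_sub_sq_real p.1 p.2, norm_add_sq_real p.1 p.2, sq_nonneg ‖p.1 + p.2‖]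
  calc normalRelSpeed n p ^ 2 ≤ ‖p.1 - p.2‖ ^ 2 := sq_le_sq.2 (h1.trans (le_abs_self _))
    _ ≤ _ := h2

/-- After a transmission the normal relative kinetic energy has paid the jump:
`g'² = g² - 4 ΔV`. The transmission condition excludes grazing. [cite: Santos2005, §2] -/
theorem transmittedNormalSpeed_sq {V₀ g : ℝ} (h : 4 * shoulderJump V₀ g < g ^ 2) :
    transmittedNormalSpeed V₀ g ^ 2 = g ^ 2 - 4 * shoulderJump V₀ g := by
  unfold transmittedNormalSpeed shoulderJump at *
  by_cases hg : g < 0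
  · simp only [if_pos hg] at h ⊢
    rw [neg_sq, Real.sq_sqrt (by linarith)]
  · simp only [if_neg hg] at h ⊢
    by_cases hg' : 0 < g
    · simp only [if_pos hg'] at h ⊢
      rw [Real.sq_sqrt (by linarith)]
      ring
    · simp only [if_neg hg'] at h
      have h0 : g = 0 := le_antisymm (not_lt.1 hg') (not_lt.1 hg)
      subst h0
      norm_num at h

/-- Transmission branch of the pair rule. [cite: Santos2005, §2] -/
theorem shoulderVel_of_lt {V₀ : ℝ} {n : E} {p : E × E}
    (h : 4 * shoulderJump V₀ (normalRelSpeed n p) < normalRelSpeed n p ^ 2) :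
    shoulderVel V₀ n p = setNormalRelSpeed n p (transmittedNormalSpeed V₀ (normalRelSpeed n p)) := by
  rw [shoulderVel, if_pos h]

/-- Reflection branch of the pair rule: below threshold the pair collides as hard spheres.
[cite: Santos2005, §2] -/
theorem shoulderVel_of_not_lt {V₀ : ℝ} {n : E} {p : E × E}
    (h : ¬4 * shoulderJump V₀ (normalRelSpeed n p) < normalRelSpeed n p ^ 2) :
    shoulderVel V₀ n p = reflectVel n p := by
  rw [shoulderVel, if_neg h]

/-- At `n = 0` the pair rule is the identity (documented junk value). [folklore] -/
@[simp]
theorem shoulderVel_zero (V₀ : ℝ) (p : E × E) : shoulderVel V₀ (0 : E) p = p := by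
  unfold shoulderVel
  split_ifs
  · simp [setNormalRelSpeed]
  · exact reflectVel_zero p

/-- **Conservation of momentum** in a square-shoulder event: `v' + w' = v + w`. [cite: Santos2005, §2] -/
theorem shoulderVel_fst_add_snd (V₀ : ℝ) (n : E) (p : E × E) :
    (shoulderVel V₀ n p).1 + (shoulderVel V₀ n p).2 = p.1 + p.2 := by
  unfold shoulderVel
  split_ifs
  · exact setNormalRelSpeed_fst_add_snd _ _ _
  · exact reflectVel_fst_add_reflectVel_snd _ _

/-- **Conservation of energy** in a transmission: the kinetic energy of the pair pays the jump,
`½(‖v'‖² + ‖w'‖²) + ΔV = ½(‖v‖² + ‖w‖²)` (`n ≠ 0`). [cite: Santos2005, §2] -/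
theorem kinetic_shoulderVel_add_shoulderJump {V₀ : ℝ} {n : E} (hn : n ≠ 0) {p : E × E}
    (h : 4 * shoulderJump V₀ (normalRelSpeed n p) < normalRelSpeed n p ^ 2) :
    2⁻¹ * (‖(shoulderVel V₀ n p).1‖ ^ 2 + ‖(shoulderVel V₀ n p).2‖ ^ 2) +
        shoulderJump V₀ (normalRelSpeed n p) = 2⁻¹ * (‖p.1‖ ^ 2 + ‖p.2‖ ^ 2) := by
  rw [shoulderVel_of_lt h, norm_sq_setNormalRelSpeed hn, transmittedNormalSpeed_sq h]
  ring

/-- **Conservation of energy** in a reflection: the kinetic energy of the pair is unchanged. [cite: Santos2005, §2] -/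
theorem kinetic_shoulderVel_of_not_lt {V₀ : ℝ} {n : E} {p : E × E}
    (h : ¬4 * shoulderJump V₀ (normalRelSpeed n p) < normalRelSpeed n p ^ 2) :
    ‖(shoulderVel V₀ n p).1‖ ^ 2 + ‖(shoulderVel V₀ n p).2‖ ^ 2 = ‖p.1‖ ^ 2 + ‖p.2‖ ^ 2 := by
  rw [shoulderVel_of_not_lt h]
  exact norm_sq_reflectVel_fst_add_norm_sq_reflectVel_snd n p

/-- After a transmission the normal relative speed is `transmittedNormalSpeed V₀ g_n` (`n ≠ 0`). [cite: Santos2005, §2] -/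
theorem normalRelSpeed_shoulderVel_of_lt {V₀ : ℝ} {n : E} (hn : n ≠ 0) {p : E × E}
    (h : 4 * shoulderJump V₀ (normalRelSpeed n p) < normalRelSpeed n p ^ 2) :
    normalRelSpeed n (shoulderVel V₀ n p) = transmittedNormalSpeed V₀ (normalRelSpeed n p) := by
  rw [shoulderVel_of_lt h, normalRelSpeed_setNormalRelSpeed hn]

/-- After a reflection the normal relative speed is reversed (`n ≠ 0`). [folklore] -/
theorem normalRelSpeed_shoulderVel_of_not_lt {V₀ : ℝ} {n : E} (hn : n ≠ 0) {p : E × E}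
    (h : ¬4 * shoulderJump V₀ (normalRelSpeed n p) < normalRelSpeed n p ^ 2) :
    normalRelSpeed n (shoulderVel V₀ n p) = -normalRelSpeed n p := by
  rw [shoulderVel_of_not_lt h, ← setNormalRelSpeed_neg_normalRelSpeed,
    normalRelSpeed_setNormalRelSpeed hn]

/-- **Hard-sphere regime.** A pair that is not receding and whose kinetic energy
`½(‖v‖² + ‖w‖²)` is at most the height `V₀` cannot climb the shoulder (`g_n² ≤ 2(‖v‖² + ‖w‖²) ≤ 4V₀`)
and is specularly reflected: the rule is the hard-sphere law. [cite: Santos2005, §2] -/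
theorem shoulderVel_eq_reflectVel_of_norm_sq_le {V₀ : ℝ} {n : E} {p : E × E}
    (hE : ‖p.1‖ ^ 2 + ‖p.2‖ ^ 2 ≤ 2 * V₀) (hg : ¬0 < normalRelSpeed n p) :
    shoulderVel V₀ n p = reflectVel n p := by
  apply shoulderVel_of_not_lt
  intro h
  unfold shoulderJump at h
  by_cases hg' : normalRelSpeed n p < 0
  · rw [if_pos hg'] at h
    have := normalRelSpeed_sq_le n p
    linarith
  · rw [if_neg hg', if_neg hg] at h
    have h0 : normalRelSpeed n p = 0 := le_antisymm (not_lt.1 hg) (not_lt.1 hg')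
    rw [h0] at h
    norm_num at h

end PairRule

/-! ## The event map, overlapping pairs and the energy -/

section Kinetic

variable {d : Type*} [Fintype d] {X : Type*} {N : ℕ}

/-- The square-shoulder event of the pair `(i, j)` in the configuration `z`: positions unchanged,
the velocities `(v_i, v_j)` replaced by `shoulderVel V₀ (x_i - x_j) (v_i, v_j)` (transmission or
specular reflection, Santos 2005 §2); the analogue of `collidePair`. Only meaningful for `i ≠ j`. [cite: Santos2005, §2] -/
def shoulderCollidePair (G : Geometry d X) (V₀ : ℝ) (i j : Fin N) (z : Config N d X) :
    Config N d X :=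
  Function.update (Function.update z i
    ((z i).1, (shoulderVel V₀ (G.sepVec (z i).1 (z j).1) ((z i).2, (z j).2)).1)) j
    ((z j).1, (shoulderVel V₀ (G.sepVec (z i).1 (z j).1) ((z i).2, (z j).2)).2)

variable {G : Geometry d X} {V₀ : ℝ} {i j : Fin N}

/-- After the event of `(i, j)`, particle `i` has the new velocity and unchanged position. [folklore] -/
theorem shoulderCollidePair_apply_left (hij : i ≠ j) (z : Config N d X) :
    shoulderCollidePair G V₀ i j z i =
      ((z i).1, (shoulderVel V₀ (G.sepVec (z i).1 (z j).1) ((z i).2, (z j).2)).1) := by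
  simp [shoulderCollidePair, Function.update_of_ne hij]

/-- After the event of `(i, j)`, particle `j` has the new velocity and unchanged position. [folklore] -/
theorem shoulderCollidePair_apply_right (z : Config N d X) :
    shoulderCollidePair G V₀ i j z j =
      ((z j).1, (shoulderVel V₀ (G.sepVec (z i).1 (z j).1) ((z i).2, (z j).2)).2) := by
  simp [shoulderCollidePair]

/-- Particles other than `i, j` are unaffected by the event of `(i, j)`. [folklore] -/
theorem shoulderCollidePair_apply_of_ne {k : Fin N} (hki : k ≠ i) (hkj : k ≠ j)
    (z : Config N d X) : shoulderCollidePair G V₀ i j z k = z k := by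
  simp [shoulderCollidePair, Function.update_of_ne hki, Function.update_of_ne hkj]

/-- An event does not move the particles. [folklore] -/
@[simp]
theorem shoulderCollidePair_apply_fst (z : Config N d X) (k : Fin N) :
    (shoulderCollidePair G V₀ i j z k).1 = (z k).1 := by
  by_cases hkj : k = j
  · subst hkj; rw [shoulderCollidePair_apply_right]
  by_cases hki : k = i
  · subst hki; rw [shoulderCollidePair_apply_left hkj]
  rw [shoulderCollidePair_apply_of_ne hki hkj]

/-- A sum over `Fin N` splits off the two terms at `i ≠ j`. [folklore] -/
private theorem sum_eq_add_add_sum_erase {M : Type*} [AddCommMonoid M] (hij : i ≠ j)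
    (f : Fin N → M) : ∑ k, f k = f i + f j + ∑ k ∈ (Finset.univ.erase i).erase j, f k := by
  have hj : j ∈ Finset.univ.erase i := Finset.mem_erase.2 ⟨hij.symm, Finset.mem_univ j⟩
  rw [← Finset.add_sum_erase _ _ (Finset.mem_univ i), ← Finset.add_sum_erase _ _ hj, add_assoc]

/-- A velocity sum over the configuration after the event of `(i, j)`: the pair contributes its
new velocities, every other particle its old one. [folklore] -/
private theorem sum_shoulderCollidePair {M : Type*} [AddCommMonoid M] (hij : i ≠ j)
    (z : Config N d X) (φ : EuclideanSpace ℝ d → M) :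
    ∑ k, φ (shoulderCollidePair G V₀ i j z k).2 =
      φ (shoulderVel V₀ (G.sepVec (z i).1 (z j).1) ((z i).2, (z j).2)).1 +
        φ (shoulderVel V₀ (G.sepVec (z i).1 (z j).1) ((z i).2, (z j).2)).2 +
        ∑ k ∈ (Finset.univ.erase i).erase j, φ (z k).2 := by
  rw [sum_eq_add_add_sum_erase hij (fun k => φ (shoulderCollidePair G V₀ i j z k).2),
    shoulderCollidePair_apply_left hij, shoulderCollidePair_apply_right]
  congr 1
  refine Finset.sum_congr rfl fun k hk => ?_
  simp only [Finset.mem_erase] at hk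
  rw [shoulderCollidePair_apply_of_ne hk.2.1 hk.1]

/-- **Conservation of momentum** in a square-shoulder event. [cite: Santos2005, §2] -/
theorem configMomentum_shoulderCollidePair (hij : i ≠ j) (z : Config N d X) :
    configMomentum (shoulderCollidePair G V₀ i j z) = configMomentum z := by
  unfold configMomentum
  rw [sum_shoulderCollidePair hij z (fun v => v), sum_eq_add_add_sum_erase hij (fun k => (z k).2),
    shoulderVel_fst_add_snd]

/-- **Energy bookkeeping of a transmission**: the kinetic energy of the configuration pays the jump
`ΔV = ±V₀` (the number of overlapping pairs changes by `±1` right after the event), for a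
non-degenerate separation vector. [cite: Santos2005, §2] -/
theorem configEnergy_shoulderCollidePair_add_shoulderJump (hij : i ≠ j) {z : Config N d X}
    (hn : G.sepVec (z i).1 (z j).1 ≠ 0)
    (h : 4 * shoulderJump V₀ (normalRelSpeed (G.sepVec (z i).1 (z j).1) ((z i).2, (z j).2)) <
      normalRelSpeed (G.sepVec (z i).1 (z j).1) ((z i).2, (z j).2) ^ 2) :
    configEnergy (shoulderCollidePair G V₀ i j z) +
        shoulderJump V₀ (normalRelSpeed (G.sepVec (z i).1 (z j).1) ((z i).2, (z j).2)) =
      configEnergy z := by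
  unfold configEnergy
  rw [sum_shoulderCollidePair hij z (fun v => ‖v‖ ^ 2),
    sum_eq_add_add_sum_erase hij (fun k => ‖(z k).2‖ ^ 2)]
  have key := kinetic_shoulderVel_add_shoulderJump (V₀ := V₀) hn h
  linarith

/-- **Energy bookkeeping of a reflection**: the kinetic energy is unchanged. [cite: Santos2005, §2] -/
theorem configEnergy_shoulderCollidePair_of_not_lt (hij : i ≠ j) {z : Config N d X}
    (h : ¬4 * shoulderJump V₀ (normalRelSpeed (G.sepVec (z i).1 (z j).1) ((z i).2, (z j).2)) <
      normalRelSpeed (G.sepVec (z i).1 (z j).1) ((z i).2, (z j).2) ^ 2) :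
    configEnergy (shoulderCollidePair G V₀ i j z) = configEnergy z := by
  unfold configEnergy
  rw [sum_shoulderCollidePair hij z (fun v => ‖v‖ ^ 2),
    sum_eq_add_add_sum_erase hij (fun k => ‖(z k).2‖ ^ 2), kinetic_shoulderVel_of_not_lt h]

/-- **Hard-sphere regime of the event map.** If the total kinetic energy of the configuration is
at most the height `V₀` and the pair `(i, j)` is not receding, the square-shoulder event is the
elastic hard-sphere collision `collidePair` (no pair can climb the shoulder). This is the
deterministic core of "`V₀ = +∞` is the hard-sphere flow". [cite: Santos2005, §2] -/
theorem shoulderCollidePair_eq_collidePair_of_configEnergy_le (hij : i ≠ j) {z : Config N d X}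
    (hE : configEnergy z ≤ V₀) (hout : ¬IsOutgoing G z i j) :
    shoulderCollidePair G V₀ i j z = collidePair G i j z := by
  have hV : shoulderVel V₀ (G.sepVec (z i).1 (z j).1) ((z i).2, (z j).2) =
      reflectVel (G.sepVec (z i).1 (z j).1) ((z i).2, (z j).2) := by
    apply shoulderVel_eq_reflectVel_of_norm_sq_le
    · have hsum : ‖(z i).2‖ ^ 2 + ‖(z j).2‖ ^ 2 ≤ ∑ k, ‖(z k).2‖ ^ 2 := by
        rw [← Finset.sum_pair (f := fun k => ‖(z k).2‖ ^ 2) hij]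
        exact Finset.sum_le_sum_of_subset_of_nonneg (Finset.subset_univ _)
          fun k _ _ => sq_nonneg _
      unfold configEnergy at hE
      linarith
    · intro h
      apply hout
      unfold IsOutgoing
      rw [normalRelSpeed] at h
      rw [real_inner_comm]
      rcases div_pos_iff.1 h with h' | h'
      · exact h'.1
      · exact absurd h'.2 (not_lt.2 (norm_nonneg _))
  unfold shoulderCollidePair collidePair
  rw [hV]

variable (G)

/-- The overlapping (unordered) pairs of a configuration: `i < j` with `‖x_i - x_j‖ < ε`, i.e. the
pairs inside each other's core, each carrying potential energy `V₀` (Santos 2005 §2, eq. (1)). [cite: Santos2005, §2 eq. (1)] -/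
def overlapPairs (ε : ℝ) (z : Config N d X) : Finset (Fin N × Fin N) :=
  Finset.univ.filter fun q => q.1 < q.2 ∧ ‖G.sepVec (z q.1).1 (z q.2).1‖ < ε

/-- The conserved energy of the square-shoulder system: kinetic energy plus `V₀` per overlapping
pair, `H = ½ ∑ ‖v_i‖² + V₀ · #{i < j : ‖x_i - x_j‖ < ε}` (Santos 2005 §2, eq. (1)). [cite: Santos2005, §2 eq. (1)] -/
def shoulderEnergy (V₀ ε : ℝ) (z : Config N d X) : ℝ :=
  configEnergy z + V₀ * ((overlapPairs G ε z).card : ℝ)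

variable {G}

/-- Membership in the set of overlapping pairs. [folklore] -/
@[simp]
theorem mem_overlapPairs {ε : ℝ} {z : Config N d X} {q : Fin N × Fin N} :
    q ∈ overlapPairs G ε z ↔ q.1 < q.2 ∧ ‖G.sepVec (z q.1).1 (z q.2).1‖ < ε := by
  simp [overlapPairs]

/-- Unfolding lemma for the energy. [folklore] -/
theorem shoulderEnergy_eq (V₀ ε : ℝ) (z : Config N d X) :
    shoulderEnergy G V₀ ε z = configEnergy z + V₀ * ((overlapPairs G ε z).card : ℝ) := rfl

/-- In the hard-sphere domain no pair overlaps. [folklore] -/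
theorem overlapPairs_eq_empty_of_mem_hardSphereDomain {ε : ℝ} {z : Config N d X}
    (hz : z ∈ hardSphereDomain G N ε) : overlapPairs G ε z = ∅ := by
  refine Finset.eq_empty_of_forall_notMem fun q hq => ?_
  rw [mem_overlapPairs] at hq
  exact absurd (hz q.1 q.2 (ne_of_lt hq.1)) (not_le.2 hq.2)

/-- In the hard-sphere domain the square-shoulder energy is the kinetic energy. [folklore] -/
theorem shoulderEnergy_of_mem_hardSphereDomain {V₀ ε : ℝ} {z : Config N d X}
    (hz : z ∈ hardSphereDomain G N ε) : shoulderEnergy G V₀ ε z = configEnergy z := by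
  rw [shoulderEnergy, overlapPairs_eq_empty_of_mem_hardSphereDomain hz]
  simp

variable (G)

/-- The event (crossing) times of a curve `γ` in phase space: times at which some pair `i ≠ j` is
exactly at the range, `‖x_i - x_j‖ = ε` (the analogue of `collisionTimes`, without the hard-core
constraint). [folklore] -/
def crossingTimes (ε : ℝ) (γ : ℝ → Config N d X) : Set ℝ :=
  {t | ∃ i j : Fin N, i ≠ j ∧ ‖G.sepVec (γ t i).1 (γ t j).1‖ = ε}

/-- The pair `(i, j)` of `z` is CRITICAL for the step of height `V₀`: its normal relative kinetic
energy equals the jump it meets, `g_n² = 4 ΔV` (entering with `g_n²/4 = V₀`, or leaving a well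
with `g_n²/4 = -V₀`; grazing pairs count as critical). At such events the rule is discontinuous;
they are excluded from trajectories (a null set of data). [folklore] -/
def IsShoulderCritical (V₀ : ℝ) (z : Config N d X) (i j : Fin N) : Prop :=
  4 * shoulderJump V₀ (normalRelSpeed (G.sepVec (z i).1 (z j).1) ((z i).2, (z j).2)) =
    normalRelSpeed (G.sepVec (z i).1 (z j).1) ((z i).2, (z j).2) ^ 2

variable {G}

/-- Membership in the set of crossing times. [folklore] -/
theorem mem_crossingTimes {ε : ℝ} {γ : ℝ → Config N d X} {t : ℝ} :
    t ∈ crossingTimes G ε γ ↔ ∃ i j : Fin N, i ≠ j ∧ ‖G.sepVec (γ t i).1 (γ t j).1‖ = ε :=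
  Iff.rfl

/-! ## Square-shoulder trajectories -/

section Trajectory

variable [TopologicalSpace X]

/-- `γ : ℝ → Config N d X` is a *square-shoulder trajectory* of `N` unit-mass particles with the
step pair potential `V₀ · 1(r < ε)` in the geometry `G` (event-driven step-potential dynamics,
standard in molecular dynamics since Alder–Wainwright 1959; binary rule of Santos 2005 §2), the
analogue of `IsHardSphereTrajectory`: crossing times are locally finite, positions are continuous,
the motion is free flight on every crossing-free interval `(s, t]` (so velocities are
right-continuous), and at a crossing time exactly one pair `{i, j}` is at the range, the left limit
`z⁻` exists, is neither grazing nor critical, and `γ t = shoulderCollidePair G V₀ i j z⁻`. [folklore] -/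
structure IsSquareShoulderTrajectory (G : Geometry d X) (V₀ ε : ℝ) (N : ℕ)
    (γ : ℝ → Config N d X) : Prop where
  /-- Crossing times are locally finite. -/
  locFinite : ∀ a b, (crossingTimes G ε γ ∩ Icc a b).Finite
  /-- Positions are continuous in time. -/
  pos_continuous : ∀ i, Continuous fun t => (γ t i).1
  /-- Free flight on crossing-free intervals `(s, t]`. -/
  free : ∀ s t, s ≤ t → (∀ τ ∈ Ioc s t, τ ∉ crossingTimes G ε γ) →
    γ t = freeFlight G (t - s) (γ s)
  /-- At a crossing time a single pair is at the range, and it is resolved from a non-grazing,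
  non-critical left limit by the square-shoulder rule. -/
  binary : ∀ t (i j : Fin N), i ≠ j → ‖G.sepVec (γ t i).1 (γ t j).1‖ = ε →
    (∀ i' j' : Fin N, i' ≠ j' → ‖G.sepVec (γ t i').1 (γ t j').1‖ = ε →
      ({i', j'} : Finset (Fin N)) = {i, j}) ∧
    ∃ zl, Tendsto γ (𝓝[<] t) (𝓝 zl) ∧ ¬IsGrazing G zl i j ∧ ¬IsShoulderCritical G V₀ zl i j ∧
      γ t = shoulderCollidePair G V₀ i j zl

namespace IsSquareShoulderTrajectory

variable {ε : ℝ} {γ : ℝ → Config N d X}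

/-- A square-shoulder trajectory with no crossing in `(s, t]` is free flight there. [folklore] -/
theorem eq_freeFlight (h : IsSquareShoulderTrajectory G V₀ ε N γ) {s t : ℝ} (hst : s ≤ t)
    (hfree : ∀ τ ∈ Ioc s t, τ ∉ crossingTimes G ε γ) : γ t = freeFlight G (t - s) (γ s) :=
  h.free s t hst hfree

end IsSquareShoulderTrajectory

end Trajectory

/-! ## The square-shoulder flow (hypothesis structure) -/

section Flow

variable [MeasureSpace X] [TopologicalSpace X]

/-- The global square-shoulder flow of `N` unit-mass particles with the step pair potential
`V₀ · 1(r < ε)` in the geometry `G`, bundled with its defining properties — the analogue of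
`HardSphereFlow` (Alexander-type almost-everywhere dynamics): a measurable, invariant,
Lebesgue-conull *good set* of initial data (no grazing, critical or multiple events, locally
finitely many events), on which `flow` is a one-parameter group of square-shoulder trajectories,
each `flow t` being measurable and preserving the Liouville (= Lebesgue) measure `volume` of the
whole phase space `Config N d X`. Outside `good` the values of `flow` are unspecified. [folklore] -/
structure SquareShoulderFlow (G : Geometry d X) (V₀ ε : ℝ) (N : ℕ) where
  /-- The flow map `(t, z) ↦ Φ_t z`. -/
  flow : ℝ → Config N d X → Config N d X
  /-- The good set of initial data on which the dynamics is globally defined. -/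
  good : Set (Config N d X)
  /-- The good set is measurable. -/
  measurableSet_good : MeasurableSet good
  /-- The good set has full Lebesgue (Liouville) measure. -/
  measure_compl_good : volume goodᶜ = 0
  /-- The good set is invariant under the flow. -/
  mapsTo_good : ∀ t, MapsTo (flow t) good good
  /-- `Φ_0 = id` on the good set. -/
  flow_zero : ∀ z ∈ good, flow 0 z = z
  /-- The group property `Φ_{s+t} = Φ_s ∘ Φ_t` on the good set. -/
  flow_add : ∀ s t, ∀ z ∈ good, flow (s + t) z = flow s (flow t z)
  /-- Each time-`t` map is measurable. -/
  measurable_flow : ∀ t, Measurable (flow t)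
  /-- Orbits of good points are square-shoulder trajectories. -/
  isTrajectory : ∀ z ∈ good, IsSquareShoulderTrajectory G V₀ ε N fun t => flow t z
  /-- Each time-`t` map preserves the Liouville (Lebesgue) measure. -/
  measurePreserving : ∀ t, MeasurePreserving (flow t) volume volume

namespace SquareShoulderFlow

variable {ε : ℝ}

/-- A square-shoulder flow coerces to its flow map. [folklore] -/
instance instCoeFun :
    CoeFun (SquareShoulderFlow G V₀ ε N) fun _ => ℝ → Config N d X → Config N d X :=
  ⟨SquareShoulderFlow.flow⟩

/-- Lebesgue-almost every configuration is good. [folklore] -/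
theorem ae_mem_good (Φ : SquareShoulderFlow G V₀ ε N) : ∀ᵐ z ∂(volume : Measure (Config N d X)),
    z ∈ Φ.good :=
  Φ.measure_compl_good

/-- On the good set `Φ_{-t}` inverts `Φ_t`. [folklore] -/
theorem flow_neg_flow (Φ : SquareShoulderFlow G V₀ ε N) (t : ℝ) {z : Config N d X}
    (hz : z ∈ Φ.good) : Φ.flow (-t) (Φ.flow t z) = z := by
  rw [← Φ.flow_add (-t) t z hz, neg_add_cancel, Φ.flow_zero z hz]

/-- The law at time `t` of the system started from the initial law `P₀`: `(Φ_t)_* P₀`. [folklore] -/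
def lawAt (Φ : SquareShoulderFlow G V₀ ε N) (P₀ : Measure (Config N d X)) (t : ℝ) :
    Measure (Config N d X) :=
  P₀.map (Φ.flow t)

/-- Unfolding lemma for `lawAt`. [folklore] -/
@[simp]
theorem lawAt_eq (Φ : SquareShoulderFlow G V₀ ε N) (P₀ : Measure (Config N d X)) (t : ℝ) :
    Φ.lawAt P₀ t = P₀.map (Φ.flow t) := rfl

/-- The Lebesgue measure is invariant: its law at time `t` is itself. [folklore] -/
theorem lawAt_volume (Φ : SquareShoulderFlow G V₀ ε N) (t : ℝ) :
    Φ.lawAt volume t = volume :=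
  (Φ.measurePreserving t).map_eq

end SquareShoulderFlow

end Flow

end Kinetic

end

end Literature.Analysis.FluidPDE
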